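import Summits.AtomisticToContinuum.Crystallization.Theorems.ChartedZeroExcessLayeredLatticeLiouvilleZZZYRCVN

/-!
# Charted zero-excess layered-lattice Liouville — ZZZYRCVP: the MIDDLE CLASS from the decided slabs (glue to `schemeDominatedOnP_king_table`)

Cell `decomp-a2c`, lens 2 «structural dichotomy (special | generic)», generation 99.  The three-way cover of record (critic r1843) needs, for
the MIDDLE class (ideal length `> 24`, actual length `≤ 64`), the hypotheses `hPM` / `hT` of «ZZZYRCV» `schemeDominatedOnP_king_table` with a
concrete finite vector set `M`, floor `F` and table `T`.  This file discharges everything except the reader's geometric placement: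

* §1 MEMBERS LIE IN A BOX: `xiFloor v ≤ HI2`, `4·HI2 < 3(3Gb+1)²`, `HI2 < 6(Mm+1)²` ⇒ `|v₀|, |v₁| ≤ Gb`, `|v₂| ≤ Mm`
  (`4·qhex(a,b) ≥ 3a², 3b²`; one registry offset `|d| ≤ 2` realises the floor);
* §2 the member set as a `Finset`: `xiMset HI1 HI2 Gb Mm = (box).filter xiMemB` with the Boolean test `xiMemB ↔ xiMember` (no classical
  instance), `mem_xiMset` (every member is in it), `of_mem_xiMset`;
* §3 `sum_le_slabs`: over a LIST of decided slabs `(xLo, certs, B)` (each `xiSlab K HI1 HI2 xLo yLo certs = some B`, rows of length `nr`)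
  whose column ranges cover the first coordinates of `S`: `Σ_{v ∈ S} kcnt v δ · n(v)/F(v)⁴ ≤ (Σ_slabs B[code3 δ])/K` (ZZZYRCVN `xiSlab_sound_real`
  slab by slab, peeling `S` by column range);
* §4 ★★★ `schemeDominatedOnP_middle`: from the slab list, the box dials, row/column coverage of `[−Gb, Gb]`, and the GEOMETRIC PLACEMENT
  `hgeo : ϱ < ‖e_x‖ → P x → xiMember HI1 HI2 (x.2 − x.1) ∧ λ²·xiFloor (x.2 − x.1) ≤ 9‖e_x‖²` (the reader's registry-floor lemma + ideal-length
  comparison, «ZZZYRCX»), the king path system is `SchemeDominatedOnP ϱ α a b w kingN kingZ P Θ_R Θ_N` with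
  `Θ_R(y) = (1+α)·λ⁻⁸·(45927/K)·Σ_slabs B_s[code3 (y.2 − y.1)]`, `Θ_N(y) = (1+α⁻¹)·λ⁻⁸·(45927/K)·Σ_slabs …` — with `K = 45927·2^60` this is
  `Σ_s B_s[code3 δ]/2^60`, whose maximum over `δ` in the decided table (HI1 = 5184, HI2 = 40000) is `3.042e-4` (XI_TABLE_5184_40000);
* §5 the production dials `Gb = 78`, `Mm = 81`, rows `yLo = −78, nr = 157` discharge the box hypotheses at `HI2 = 40000` (`norm_num` / `omega`);
  the column coverage `hx` is discharged in the instance file from the five K-files' `xLo` and certificate lengths.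

Theorem file (3 defs, 13 theorems); imports ZZZYRCVN; no instance / notation / option; 0 sorry. [g99]
-/

namespace Summit.AtomisticToContinuum.Crystallization.Theorems.ChartedZeroExcessLayeredLatticeLiouville

open scoped BigOperators
open Summit.AtomisticToContinuum.Crystallization.Theorems.ChartedPlanarOrderRigidityDoor (E3)

/-! ### §1 Members lie in a box -/

/-- `4(a² + ab + b²) ≥ 3a²`. [g99] -/
theorem xiQhex_ge_left (a b : ℤ) : 3 * (a * a) ≤ 4 * xiQhex a b := by
  unfold xiQhex; nlinarith [sq_nonneg (a + 2 * b)]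

/-- `4(a² + ab + b²) ≥ 3b²`. [g99] -/
theorem xiQhex_ge_right (a b : ℤ) : 3 * (b * b) ≤ 4 * xiQhex a b := by
  unfold xiQhex; nlinarith [sq_nonneg (2 * a + b)]

/-- a floor `≤ HI2` exhibits one registry offset `|d| ≤ 2` with `qhex(3x+d, 3y+d) ≤ HI2` (and `6m² ≤ HI2`). [g99] -/
theorem exists_offset_of_xiFloor_le {HI2 : ℕ} {v : Cell 2 × ℤ} (hv : xiFloor v ≤ HI2) :
    (∃ d : ℤ, -2 ≤ d ∧ d ≤ 2 ∧ xiQhex (3 * v.1 0 + d) (3 * v.1 1 + d) ≤ HI2) ∧ 6 * v.2.natAbs * v.2.natAbs ≤ HI2 := by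
  unfold xiFloor at hv
  by_cases hm : v.2 = 0
  · rw [if_pos hm] at hv
    unfold xiQ0 at hv
    refine ⟨⟨0, by norm_num, by norm_num, ?_⟩, by rw [hm]; simp⟩
    rw [add_zero, add_zero]; exact (Int.toNat_le.mp hv)
  · rw [if_neg hm] at hv
    refine ⟨?_, by omega⟩
    have hq : xiQmn (v.1 0) (v.1 1) ≤ HI2 := by omega
    unfold xiQmn at hq
    simp only [min_le_iff] at hq
    rcases hq with ((h | h) | (h | h)) | h
    · exact ⟨0, by norm_num, by norm_num, by rw [add_zero, add_zero]; exact Int.toNat_le.mp h⟩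
    · exact ⟨1, by norm_num, by norm_num, Int.toNat_le.mp h⟩
    · exact ⟨-1, by norm_num, by norm_num, by rw [← sub_eq_add_neg, ← sub_eq_add_neg]; exact Int.toNat_le.mp h⟩
    · exact ⟨2, by norm_num, by norm_num, Int.toNat_le.mp h⟩
    · exact ⟨-2, by norm_num, by norm_num, by rw [← sub_eq_add_neg, ← sub_eq_add_neg]; exact Int.toNat_le.mp h⟩

/-- from `3(3x+d)² ≤ 4·HI2 < 3(3(Gb+1) − 2)²` and `|d| ≤ 2`: `|x| ≤ Gb`. [g99] -/
theorem natAbs_le_of_sq_bound {HI2 Gb : ℕ} (hG : 4 * HI2 < 3 * (3 * (Gb + 1) - 2) ^ 2) {x d : ℤ} (hd : -2 ≤ d ∧ d ≤ 2)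
    (h : 3 * ((3 * x + d) * (3 * x + d)) ≤ 4 * (HI2 : ℤ)) : x.natAbs ≤ Gb := by
  by_contra hx
  have hx' : Gb + 1 ≤ x.natAbs := by omega
  have h2 : 3 * Gb + 1 ≤ (3 * x + d).natAbs := by omega
  have h3 : (3 * Gb + 1) * (3 * Gb + 1) ≤ (3 * x + d).natAbs * (3 * x + d).natAbs := Nat.mul_le_mul h2 h2
  have h4 : ((3 * x + d).natAbs : ℤ) * ((3 * x + d).natAbs : ℤ) = (3 * x + d) * (3 * x + d) := by
    rw [← sq, Int.natAbs_sq, sq]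
  have h5 : (((3 * Gb + 1) * (3 * Gb + 1) : ℕ) : ℤ) ≤ (3 * x + d) * (3 * x + d) := by
    rw [← h4]; exact_mod_cast h3
  have h6 : 3 * (Gb + 1) - 2 = 3 * Gb + 1 := by omega
  rw [h6] at hG
  have h7 : (4 * HI2 : ℤ) < 3 * ((3 * Gb + 1) * (3 * Gb + 1) : ℕ) := by rw [← sq]; exact_mod_cast hG
  push_cast at h5 h7
  linarith

/-- ★ MEMBERS LIE IN THE BOX: `xiFloor v ≤ HI2` with `4·HI2 < 3(3Gb+1)²` and `HI2 < 6(Mm+1)²` gives `|v₀|, |v₁| ≤ Gb`, `|v₂| ≤ Mm`. [g99] -/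
theorem box_of_xiFloor_le {HI2 Gb Mm : ℕ} (hG : 4 * HI2 < 3 * (3 * (Gb + 1) - 2) ^ 2) (hM : HI2 < 6 * (Mm + 1) * (Mm + 1))
    {v : Cell 2 × ℤ} (hv : xiFloor v ≤ HI2) : (v.1 0).natAbs ≤ Gb ∧ (v.1 1).natAbs ≤ Gb ∧ v.2.natAbs ≤ Mm := by
  obtain ⟨⟨d, hd1, hd2, hq⟩, hm⟩ := exists_offset_of_xiFloor_le hv
  refine ⟨natAbs_le_of_sq_bound hG ⟨hd1, hd2⟩ (le_trans (xiQhex_ge_left _ _) (by linarith)),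
    natAbs_le_of_sq_bound hG ⟨hd1, hd2⟩ (le_trans (xiQhex_ge_right _ _) (by linarith)), ?_⟩
  by_contra hc
  have h1 : Mm + 1 ≤ v.2.natAbs := by omega
  have h2 : (Mm + 1) * (Mm + 1) ≤ v.2.natAbs * v.2.natAbs := Nat.mul_le_mul h1 h1
  have h3 : 6 * ((Mm + 1) * (Mm + 1)) ≤ 6 * (v.2.natAbs * v.2.natAbs) := Nat.mul_le_mul_left 6 h2
  rw [Nat.mul_assoc] at hM hm
  omega

/-! ### §2 The finite member set -/

/-- Boolean membership test (so that the member set is a computably filtered `Finset`; no classical instances). [g99] -/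
def xiMemB (HI1 HI2 : ℕ) (v : Cell 2 × ℤ) : Bool :=
  decide (HI1 < xiCeil v) && decide (xiFloor v ≤ HI2) && !decide (v = 0)

/-- `xiMemB = true ↔ xiMember`. [g99] -/
theorem xiMemB_iff (HI1 HI2 : ℕ) (v : Cell 2 × ℤ) : xiMemB HI1 HI2 v = true ↔ xiMember HI1 HI2 v := by
  simp [xiMemB, xiMember, and_assoc]

/-- the index box `[−Gb, Gb]² × [−Mm, Mm]` as a `Finset` of index vectors (proof-side only). [g99] -/
noncomputable def xiBox (Gb Mm : ℕ) : Finset (Cell 2 × ℤ) :=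
  ((Finset.Icc (-(Gb : ℤ)) Gb ×ˢ Finset.Icc (-(Gb : ℤ)) Gb) ×ˢ Finset.Icc (-(Mm : ℤ)) Mm).image fun t => iv3 t.1.1 t.1.2 t.2

/-- ★ THE MIDDLE VECTOR SET `M` as a `Finset`: members inside the box. [g99] -/
noncomputable def xiMset (HI1 HI2 Gb Mm : ℕ) : Finset (Cell 2 × ℤ) := (xiBox Gb Mm).filter fun v => xiMemB HI1 HI2 v = true

/-- box membership from coordinate bounds. [g99] -/
theorem mem_xiBox {Gb Mm : ℕ} {v : Cell 2 × ℤ} (h0 : (v.1 0).natAbs ≤ Gb) (h1 : (v.1 1).natAbs ≤ Gb) (h2 : v.2.natAbs ≤ Mm) :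
    v ∈ xiBox Gb Mm := by
  unfold xiBox
  refine Finset.mem_image.mpr ⟨((v.1 0, v.1 1), v.2), ?_, iv3_eta v⟩
  simp only [Finset.mem_product, Finset.mem_Icc]
  omega

/-- ★ every member (under the box dials) is in `M`. [g99] -/
theorem mem_xiMset {HI1 HI2 Gb Mm : ℕ} (hG : 4 * HI2 < 3 * (3 * (Gb + 1) - 2) ^ 2) (hM : HI2 < 6 * (Mm + 1) * (Mm + 1))
    {v : Cell 2 × ℤ} (hv : xiMember HI1 HI2 v) : v ∈ xiMset HI1 HI2 Gb Mm := by
  unfold xiMset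
  obtain ⟨h0, h1, h2⟩ := box_of_xiFloor_le hG hM hv.2.1
  exact Finset.mem_filter.mpr ⟨mem_xiBox h0 h1 h2, (xiMemB_iff HI1 HI2 v).mpr hv⟩

/-- elements of `M` are members with `|v₀|, |v₁| ≤ Gb`. [g99] -/
theorem of_mem_xiMset {HI1 HI2 Gb Mm : ℕ} {v : Cell 2 × ℤ} (hv : v ∈ xiMset HI1 HI2 Gb Mm) :
    xiMember HI1 HI2 v ∧ (v.1 0).natAbs ≤ Gb ∧ (v.1 1).natAbs ≤ Gb := by
  unfold xiMset xiBox at hv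
  obtain ⟨hb, hm⟩ := Finset.mem_filter.mp hv
  refine ⟨(xiMemB_iff HI1 HI2 v).mp hm, ?_⟩
  obtain ⟨t, ht, rfl⟩ := Finset.mem_image.mp hb
  simp only [Finset.mem_product, Finset.mem_Icc] at ht
  simp only [iv3_fst_zero, iv3_fst_one]
  omega

/-! ### §3 Summing the slab tables -/

/-- ★ SUM OVER A LIST OF DECIDED SLABS: if every slab `(xLo, certs, B)` of the list satisfies `xiSlab K HI1 HI2 xLo yLo certs = some B`
(rows of length `nr`), then for every finite set `S` of members in the rows `[yLo, yLo + nr)` whose first coordinates are covered by the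
slabs' column ranges, `Σ_{v ∈ S} kcnt v δ · n(v)/F(v)⁴ ≤ (Σ_slabs B[code3 δ]) / K`. [g99] -/
theorem sum_le_slabs {K HI1 HI2 nr : ℕ} {yLo : ℤ} (hK : 0 < K) :
    ∀ (slabs : List (ℤ × List (List (ℕ × ℕ)) × List ℕ)),
      (∀ s ∈ slabs, xiSlab K HI1 HI2 s.1 yLo s.2.1 = some s.2.2 ∧ ∀ c ∈ s.2.1, c.length = nr) →
      ∀ S : Finset (Cell 2 × ℤ), (∀ v ∈ S, xiMember HI1 HI2 v ∧ yLo ≤ v.1 1 ∧ v.1 1 < yLo + nr) →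
      (∀ v ∈ S, ∃ s ∈ slabs, s.1 ≤ v.1 0 ∧ v.1 0 < s.1 + s.2.1.length) →
      ∀ δ : Cell 2 × ℤ, ∑ v ∈ S, (kcnt v δ : ℝ) * ((kingNv v : ℝ) / (xiFloor v : ℝ) ^ 4) ≤
        ((slabs.map fun s => (s.2.2.getD (code3 δ) 0 : ℝ)).sum) / K
  | [], _, S, _, hcov, δ => by
    have hS : S = ∅ := Finset.eq_empty_of_forall_notMem fun v hv => by
      obtain ⟨s, hs, _⟩ := hcov v hv; simp at hs
    simp [hS]
  | s :: rest, hsl, S, hS, hcov, δ => by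
    classical
    rw [← Finset.sum_filter_add_sum_filter_not S (fun v => s.1 ≤ v.1 0 ∧ v.1 0 < s.1 + s.2.1.length)]
    have hs0 := hsl s (by simp)
    have h1 : ∑ v ∈ S.filter (fun v => s.1 ≤ v.1 0 ∧ v.1 0 < s.1 + s.2.1.length),
        (kcnt v δ : ℝ) * ((kingNv v : ℝ) / (xiFloor v : ℝ) ^ 4) ≤ (s.2.2.getD (code3 δ) 0 : ℝ) / K :=
      xiSlab_sound_real hK hs0.2 hs0.1 _ (fun v hv => by
        obtain ⟨hvS, hr⟩ := Finset.mem_filter.mp hv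
        obtain ⟨hm, hy1, hy2⟩ := hS v hvS
        exact ⟨hm, hr.1, hr.2, hy1, hy2⟩) δ
    have h2 := sum_le_slabs hK rest (fun s' hs' => hsl s' (by simp [hs']))
      (S.filter (fun v => ¬(s.1 ≤ v.1 0 ∧ v.1 0 < s.1 + s.2.1.length)))
      (fun v hv => hS v (Finset.mem_filter.mp hv).1)
      (fun v hv => by
        obtain ⟨hvS, hn⟩ := Finset.mem_filter.mp hv
        obtain ⟨s', hs', hr⟩ := hcov v hvS
        rcases List.mem_cons.mp hs' with rfl | hs'
        · exact absurd hr hn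
        · exact ⟨s', hs', hr⟩) δ
    simp only [List.map_cons, List.sum_cons, add_div]
    linarith

/-! ### §4 The middle class, glued to `schemeDominatedOnP_king_table` -/

/-- ★★★ **THE MIDDLE-CLASS REMAINDER FROM THE DECIDED SLABS**: given the box dials (`4·HI2 < 3(3Gb+1)²`, `HI2 < 6(Mm+1)²`, rows
`[yLo, yLo+nr) ⊇ [−Gb, Gb]`, slab column ranges covering `[−Gb, Gb]`), a list of decided slabs, and the GEOMETRIC placement of the class
(`ϱ < ‖e_x‖ ∧ P x ⇒ x.2 − x.1` is a member and `λ²·xiFloor(x.2 − x.1) ≤ 9‖e_x‖²` — the registry floor lemma + the ideal-length comparison of the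
reader), the king path system is scheme-dominated on `P` with `Θ_R(y) = (1+α)·λ⁻⁸·(45927/K)·Σ_slabs B_s[code3 (y.2 − y.1)]` and
`Θ_N(y) = (1+α⁻¹)·λ⁻⁸·(45927/K)·Σ_slabs …` (`K = 45927·2^60` in the K-files: `Σ_s B_s/2^60`). [g99] -/
theorem schemeDominatedOnP_middle {ϱ α lam : ℝ} (hα : 0 < α) (hlam : 0 < lam) {a b : E3} {w : ℤ → E3}
    (P : (Cell 2 × ℤ) × (Cell 2 × ℤ) → Prop) {K HI1 HI2 Gb Mm nr : ℕ} {yLo : ℤ} (hK : 0 < K)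
    (slabs : List (ℤ × List (List (ℕ × ℕ)) × List ℕ))
    (hsl : ∀ s ∈ slabs, xiSlab K HI1 HI2 s.1 yLo s.2.1 = some s.2.2 ∧ ∀ c ∈ s.2.1, c.length = nr)
    (hG : 4 * HI2 < 3 * (3 * (Gb + 1) - 2) ^ 2) (hM : HI2 < 6 * (Mm + 1) * (Mm + 1))
    (hy : ∀ t : ℤ, t.natAbs ≤ Gb → yLo ≤ t ∧ t < yLo + nr)
    (hx : ∀ t : ℤ, t.natAbs ≤ Gb → ∃ s ∈ slabs, s.1 ≤ t ∧ t < s.1 + s.2.1.length)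
    (hgeo : ∀ x, ϱ < ‖bondVec a b w x‖ → P x →
      xiMember HI1 HI2 (x.2 - x.1) ∧ lam ^ 2 * (xiFloor (x.2 - x.1) : ℝ) ≤ 9 * ‖bondVec a b w x‖ ^ 2) :
    SchemeDominatedOnP ϱ α a b w kingN kingZ P
      (fun y => (1 + α) * (lam ^ 8)⁻¹ * (45927 / K * (slabs.map fun s => (s.2.2.getD (code3 (y.2 - y.1)) 0 : ℝ)).sum))
      (fun y => (1 + α⁻¹) * (lam ^ 8)⁻¹ * (45927 / K * (slabs.map fun s => (s.2.2.getD (code3 (y.2 - y.1)) 0 : ℝ)).sum)) := by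
  refine schemeDominatedOnP_king_table hα hlam P (xiMset HI1 HI2 Gb Mm) xiFloor
    (fun δ => 45927 / K * (slabs.map fun s => (s.2.2.getD (code3 δ) 0 : ℝ)).sum) ?_ ?_
  · intro x hfar hP
    obtain ⟨hm, hfl⟩ := hgeo x hfar hP
    exact ⟨mem_xiMset hG hM hm, xiFloor_pos hm, hfl⟩
  · intro δ
    have h := sum_le_slabs hK slabs hsl (xiMset HI1 HI2 Gb Mm)
      (fun v hv => by
        obtain ⟨hm, _, h1⟩ := of_mem_xiMset hv
        exact ⟨hm, hy _ h1⟩)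
      (fun v hv => by
        obtain ⟨_, h0, _⟩ := of_mem_xiMset hv
        exact hx _ h0) δ
    have he : ∑ v ∈ xiMset HI1 HI2 Gb Mm, (kcnt v δ : ℝ) * kcoef xiFloor v =
        45927 * ∑ v ∈ xiMset HI1 HI2 Gb Mm, (kcnt v δ : ℝ) * ((kingNv v : ℝ) / (xiFloor v : ℝ) ^ 4) := by
      rw [Finset.mul_sum]
      refine Finset.sum_congr rfl fun v _ => ?_
      unfold kcoef; ring
    rw [he]
    have hK' : (0 : ℝ) < K := by exact_mod_cast hK
    calc (45927 : ℝ) * ∑ v ∈ xiMset HI1 HI2 Gb Mm, (kcnt v δ : ℝ) * ((kingNv v : ℝ) / (xiFloor v : ℝ) ^ 4)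
        ≤ 45927 * (((slabs.map fun s => (s.2.2.getD (code3 δ) 0 : ℝ)).sum) / K) :=
          mul_le_mul_of_nonneg_left h (by norm_num)
      _ = 45927 / K * (slabs.map fun s => (s.2.2.getD (code3 δ) 0 : ℝ)).sum := by ring

/-! ### §5 The production dials discharge the box hypotheses (documentation instances) -/

/-- at `HI2 = 40000` (`λ_min = 0.96`): `Gb = 78`, `Mm = 81` satisfy the box dials of `schemeDominatedOnP_middle`. [g99] -/
theorem middle_box_dials_40000 : 4 * 40000 < 3 * (3 * (78 + 1) - 2) ^ 2 ∧ 40000 < 6 * (81 + 1) * (81 + 1) := by norm_num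

/-- the K-files' rows `yLo = −78`, `nr = 157` contain `[−78, 78]`. [g99] -/
theorem middle_rows_78 (t : ℤ) (h : t.natAbs ≤ 78) : (-78 : ℤ) ≤ t ∧ t < -78 + ((157 : ℕ) : ℤ) := by omega

end Summit.AtomisticToContinuum.Crystallization.Theorems.ChartedZeroExcessLayeredLatticeLiouville
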